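import Summits.QuantumFields.YangMills.Theorems.BalabanUVNodesN12FlatStraightOntoRows
import Summits.QuantumFields.YangMills.Theorems.BalabanUVNodesN12FlatLinAvgOntoPins
import Summits.QuantumFields.YangMills.Theorems.BalabanUVNodesK0Stub1RecordAveragingRightInverse
import Literature.MathematicalPhysics.QuantumFieldTheory.Balaban1983to89.Node00.MultiScaleFibreChart

/-!
# DAG node N12 [B15] — (P4)′ road, step (T3♭): THE FLAT SITE BLOCK — at the flat configuration the true linearised multi-scale (0.4)-constraint `Q^{(j)}` is ONTO the `2d` rows at ANY
# `j`-site `y′` by fine fields supported on bonds CROSSING THE INTERNAL `(j−1)`-FACES of the block `B^j(y′)` (explicit: H1a's internal straight solution, far-face lifted, plus one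
# centre-spike comb correction one level down), linearly and with a letter

Cell `pub-ymgap` (HUMAN RULINGS D-0062 ∕ D-0149), width seat `pub-ymgap-dag-n12-w6` g6 = the N12 (P4) clone by row (director-ym R463-ym; repaired target `hsurj` = dag-n12-c g20's (P4)′
socket of record 2026-08-28).  Key K1⁹ `stmt-QuantumFields-27364`, `--kind proof --supports … --as helper`; count-neutral; THEOREMS ONLY (0 `def`, 0 `sorry`).  Design note
`HOME/pub-ymgap-dag-n12-w6/P4-DESIGN.md` (road: block-triangular local surjectivity; this file = the FLAT diagonal block).

CONSUMED BY NAME, nothing modified: H1a `…N12FlatStraightOntoRows.exists_bondAvg_eq_on_rows` (dag-n10-w1; the internal straight solution at one inside block), lit-balaban p21's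
`B6SectAOntoV1` (`liftIter`, `bondAvgIter_liftIter`, `liftIter_support`, `blockOf_shift_of_face`, `bondLift`), UST's `ChartHInv` (`linFamily_eq_sub_comb`, `linFamily_add`,
`linFamily_const_smul`, `combMean_congr_stairs`, `combMean_zero`, `combMean_add`, `combMean_const_smul`, `bondAvgIter_kernel_apply`, `blockOf_of_mem_walk_stairWord`), k0-s1-w1's `linFamily_realLinear`,
UST's `linAvg_eq_bondAvg_sub_grad_combMean` ∕ `linAvg_grad` ∕ `linAvg_add` ∕ `linAvg_const_smul`, n07-w2's `Node00.suProj`, H2a's `blockOf_shift_emb` ∕ `blockOf_unshift_emb`.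

THE CONSTRUCTION (site `y′` of `T^{(n+1)}`, rows `c` with `c₋ = y′` or `c₊ = y′`, target `v`).  For every `(n+1)`-bond `t` let `Z_t` be H1a's level-`n` field on the INTERNAL `n`-bonds of
`B(y′)` with `Q Z_t = δ_t` on the rows; `W := Σ_t Z_t ⊗ T_t`, `T_t := L^{−(n+1)}·v(t)`; the comb correction ONE LEVEL DOWN: `G := d𝟙_{emb y′}` (the `2d` internal `n`-bonds at the centre),
`K := λ̄(W)(y′)`; the fine field `Y := Σ_t liftIter n Z_t ⊗ T_t + liftIter n G ⊗ K` and `X := π ∘ Y` (`π = suProj`).  Below level `n` every intermediate average of a far-face lift is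
far-face supported, so every comb mean and the whole hierarchical comb functional `Λ_i`, `i ≤ n`, VANISH (a far-face bond is never internal to a block: staircases stay in their block);
hence `Q^{(n)}Y = L^n·(W + dλ)`, `λ := 𝟙_{emb y′}·K`, and ONE flat step (`linAvg = L·Q − dλ̄`, `linAvg(dλ) = λ∘emb(c₊) − λ∘emb(c₋)`) gives `Q^{(n+1)}Y(c) = L^{n+1}·T(c) = v(c)` on the
rows at `y′` (the comb mean of `W` at the other end block is `0`: `W` is internal to `B(y′)`); `π` commutes with `Q^{(n+1)}`.  SUPPORT: every bond of `Y` crosses an internal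
`n`-face of `B(y′)` (`liftIter_support` + internality of `Z_t`, `G`): both its `(n+1)`-blocks are `y′` and its two `n`-blocks DIFFER — the shape the (P4)′ footprint argument consumes.

CONTENTS.  §1 far-face bookkeeping (`farFace_bondAvgIter_liftIter`, `combMean_eq_zero_of_farFace`, `combMean_eq_zero_of_internal`, `combFamily_liftIter_kernel_eq_zero`,
`linFamily_liftIter_kernel`).  §2 ★★★ `exists_flat_siteBlock` — ∃ a real-linear `Φ` with (i) `Q^{(n+1)}(↑Φ v)(c) = ↑(v c)` at every row at `y′`, for EVERY `linAvg`-family `Q`;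
(ii) support: `Φ v b ≠ 0 ⇒ iterBlockOf (n+1) b₋ = y′ = iterBlockOf (n+1) b₊ ∧ iterBlockOf n b₋ ≠ iterBlockOf n b₊`; (iii) a letter `‖Φ v‖ ≤ C‖v‖` (sup of the `𝔰𝔲(N)` norms).

HONEST FRAMING.  Finite lattice combinatorics + linear algebra at the FLAT configuration on the tree's own averaging (composition by name; the one new identity is the vanishing of
the comb functional below the top level for far-face lifts); per-site existence constants (NOT print's volume-uniform (46)); nothing of Bałaban's asserted; N12 NOT discharged; K1⁹ NOT
closed; count-neutral (typed 28∕28 · discharged 5∕27 unmoved); R4 closes only the conditional finite-𝕋⁴ rung `BalabanLadder.UV`; the YM mass gap (Clay) is NOT proved by any of this.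
-/

noncomputable section

open scoped BigOperators Matrix.Norms.L2Operator

namespace Summit.QuantumFields.YangMills.BalabanUVNodes.N12DirectSurjSiteBlockFlat

open Literature.MathematicalPhysics.QuantumFieldTheory.Balaban1983to89
open LatticeFieldCalculus (bondAvg bondAvgIter)
open B5Eq118OneStroke (iterBlockOf iterBlockOf_zero iterBlockOf_succ)
open B5AveragingOnto (bondLift)
open B6SectAOntoV1 (liftIter liftIter_zero liftIter_succ bondAvgIter_liftIter liftIter_support blockOf_shift_of_face)
open BlockAveragingEMLLinearised (linAvg combMean linAvg_eq_bondAvg_sub_grad_combMean linAvg_grad)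
open T4Continuum (walk)
open T4AdjointCovarianceUnitary (lieSU)
open Node00 (suProj suProj_coe)
open Summit.QuantumFields.YangMills.Theorems.ChartHInv (linFamily_add linFamily_const_smul linFamily_eq_sub_comb exists_combFamily combMean_congr_stairs combMean_zero
  combMean_const_smul bondAvgIter_kernel_apply bondAvg_comp_apply blockOf_of_mem_walk_stairWord)
open Summit.QuantumFields.YangMills.Theorems.Prop7CombGauge (combMean_add)
open Summit.QuantumFields.YangMills.Theorems.Prop7LinAvgOnto (linAvg_add)
open Summit.QuantumFields.YangMills.Theorems.Prop8Chart (linAvg_const_smul)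
open Summit.QuantumFields.YangMills.Theorems.K0Stub1RecordAveragingRightInverse (linFamily_realLinear)
open Summit.QuantumFields.YangMills.BalabanUVNodes.N12FlatStraightOntoRows (exists_bondAvg_eq_on_rows)
open Summit.QuantumFields.YangMills.BalabanUVNodes.N12FlatLinAvgOntoPins (blockOf_shift_emb blockOf_unshift_emb)

variable {P : Params} {N : ℕ}

/-! ## §1  Far-face bookkeeping: below the top level a far-face lift has no comb means -/

section FarFace

/-- Every intermediate average `Q_i(liftIter n Z)`, `i < n`, is supported on FAR-FACE bonds (label `≡ L − 1 (mod L)` in its direction): it is `bondLift` of the next one.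
[cite: Balaban1984PropagatorsI, (1.11) p.19, (1.18) p.20] -/
theorem farFace_bondAvgIter_liftIter : ∀ (n : ℕ), n ≤ P.m + P.K → ∀ (Z : VecField P n ℝ) (i : ℕ), i < n →
    ∀ b : PBond P i, bondAvgIter i (liftIter n Z) b ≠ 0 → (b.src b.dir).val % P.L = P.L - 1
  | 0, _, _, _, hi, _, _ => (Nat.not_lt_zero _ hi).elim
  | n + 1, hn, Z, i, hi, b, hb => by
    rw [liftIter_succ] at hb
    rcases Nat.lt_succ_iff_lt_or_eq.1 hi with hlt | rfl
    · exact farFace_bondAvgIter_liftIter n (Nat.le_of_succ_le hn) (bondLift Z) i hlt b hb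
    · rw [bondAvgIter_liftIter i (Nat.le_of_succ_le hn)] at hb
      by_contra h
      exact hb (by unfold bondLift; rw [if_neg h])

/-- A far-face supported level-`i` field has ZERO comb mean at every block: the staircases of (0.3) use only bonds internal to their block, and a far-face bond is not internal
(its target lies in the NEXT block). [cite: Balaban1987RG1, (0.3) p.252; Balaban1985Averaging, (62) p.28] -/
theorem combMean_eq_zero_of_farFace {n : Type*} {i : ℕ} (hi : i + 1 ≤ P.m + P.K) (W : PBond P i → Matrix n n ℂ)
    (hW : ∀ b : PBond P i, W b ≠ 0 → (b.src b.dir).val % P.L = P.L - 1) (u : Site P (i + 1)) : combMean W u = 0 := by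
  rw [combMean_congr_stairs (Y' := fun _ => (0 : Matrix n n ℂ)) u fun σ r s hs => ?_]
  · exact combMean_zero u
  · by_contra h
    obtain ⟨hs1, hs2⟩ := blockOf_of_mem_walk_stairWord hi u σ r hs
    have hface := blockOf_shift_of_face hi s.bond.src s.bond.dir (hW s.bond h)
    have : blockOf s.bond.tgt = (blockOf s.bond.src).shift s.bond.dir := hface
    rw [hs2, hs1] at this
    exact T4WilsonLinkAffine.shift_ne_self u s.bond.dir this.symm

/-- A level-`i` field supported on bonds INTERNAL to the block `B(y′)` has zero comb mean at every OTHER block. [cite: Balaban1987RG1, (0.3) p.252; Balaban1985Averaging, (62) p.28] -/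
theorem combMean_eq_zero_of_internal {n : Type*} {i : ℕ} (hi : i + 1 ≤ P.m + P.K) {W : PBond P i → Matrix n n ℂ} {y' : Site P (i + 1)}
    (hW : ∀ b : PBond P i, W b ≠ 0 → blockOf b.src = y' ∧ blockOf b.tgt = y') {u : Site P (i + 1)} (hu : u ≠ y') : combMean W u = 0 := by
  rw [combMean_congr_stairs (Y' := fun _ => (0 : Matrix n n ℂ)) u fun σ r s hs => ?_]
  · exact combMean_zero u
  · by_contra h
    exact hu ((blockOf_of_mem_walk_stairWord hi u σ r hs).1.symm.trans (hW s.bond h).1)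

variable {n : Type*} (Q : (i : ℕ) → (PBond P 0 → Matrix n n ℂ) → PBond P i → Matrix n n ℂ)
  (hQ0 : ∀ Y, Q 0 Y = Y) (hQs : ∀ (i : ℕ) (Y : PBond P 0 → Matrix n n ℂ) (c : PBond P (i + 1)), Q (i + 1) Y c = linAvg (Q i Y) c)
  (Λ : (i : ℕ) → (PBond P 0 → Matrix n n ℂ) → Site P i → Matrix n n ℂ)
  (hΛ0 : ∀ Y y, Λ 0 Y y = 0)
  (hΛs : ∀ (i : ℕ) (Y : PBond P 0 → Matrix n n ℂ) (y : Site P (i + 1)), Λ (i + 1) Y y = (P.L ^ i : ℕ) • combMean (bondAvgIter i Y) y + Λ i Y (emb y))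

include hΛ0 hΛs in
/-- **THE HIERARCHICAL COMB FUNCTIONAL VANISHES BELOW THE TOP LEVEL ON FAR-FACE LIFTS**: for a fine field `Y(b) = Σ_t liftIter m (Z t)(b)·M_t` (real kernels `Z t` at level `m`,
fixed matrices `M_t`), `Λ_i(Y) = 0` for every `i ≤ m`. [cite: Balaban1985Averaging, (62) p.28; Balaban1984PropagatorsI, (1.18) p.20] -/
theorem combFamily_liftIter_kernel_eq_zero {ι : Type*} [Fintype ι] {m : ℕ} (hm : m ≤ P.m + P.K) (Z : ι → VecField P m ℝ) (M : ι → Matrix n n ℂ) :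
    ∀ (i : ℕ), i ≤ m → ∀ y : Site P i, Λ i (fun b => ∑ t, liftIter m (Z t) b • M t) y = 0
  | 0, _, y => hΛ0 _ y
  | i + 1, hi, y => by
    rw [hΛs, combFamily_liftIter_kernel_eq_zero hm Z M i (Nat.le_of_succ_le hi) (emb y), add_zero]
    rw [combMean_eq_zero_of_farFace (hi.trans hm) _ (fun b hb => ?_) y, smul_zero]
    -- the intermediate average is far-face supported
    rw [bondAvgIter_kernel_apply (fun b t => liftIter m (Z t) b) M i b] at hb
    obtain ⟨t, -, ht⟩ := Finset.exists_ne_zero_of_sum_ne_zero hb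
    exact farFace_bondAvgIter_liftIter m hm (Z t) i (Nat.lt_of_succ_le hi) b (left_ne_zero_of_smul ht)

include hQ0 hQs in
/-- **AT THE LEVEL OF THE DATA THE TRUE LINEARISATION OF A FAR-FACE LIFT IS `L^m` TIMES THE DATUM**: `Q^{(m)}(Σ_t liftIter m (Z t) ⊗ M_t)(e) = L^m·Σ_t Z_t(e)·M_t`
(`Q^{(m)} = L^m·Q_m − dΛ_m`, `Q_m ∘ liftIter m = id`, `Λ_m = 0` by the previous lemma). [cite: Balaban1984PropagatorsI, (1.18) p.20; Balaban1985Averaging, (124)-(125) p.36] -/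
theorem linFamily_liftIter_kernel {ι : Type*} [Fintype ι] {m : ℕ} (hm : m ≤ P.m + P.K) (Z : ι → VecField P m ℝ) (M : ι → Matrix n n ℂ) (e : PBond P m) :
    Q m (fun b => ∑ t, liftIter m (Z t) b • M t) e = (P.L ^ m : ℕ) • ∑ t, Z t e • M t := by
  obtain ⟨Λ, hΛ0, hΛs⟩ := exists_combFamily (P := P) (n := n)
  rw [linFamily_eq_sub_comb Q hQ0 hQs Λ hΛ0 hΛs, combFamily_liftIter_kernel_eq_zero Λ hΛ0 hΛs hm Z M m le_rfl,
    combFamily_liftIter_kernel_eq_zero Λ hΛ0 hΛs hm Z M m le_rfl, sub_self, sub_zero, bondAvgIter_kernel_apply]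
  congr 1
  refine Finset.sum_congr rfl fun t _ => ?_
  rw [show (fun b => liftIter m (Z t) b) = liftIter m (Z t) from rfl, bondAvgIter_liftIter m hm]

/-- `Q` applied to a real kernel against fixed matrices, ONE level: `Q(e ↦ Σ_t K(e,t)·M_t)(c) = Σ_t (QK(·,t))(c)·M_t` (the one-step twin of UST's `bondAvgIter_kernel_apply`).
[cite: Balaban1984PropagatorsI, (1.11) p.19] -/
theorem bondAvg_kernel_apply {ι : Type*} [Fintype ι] {j : ℕ} (K : PBond P j → ι → ℝ) (M : ι → Matrix n n ℂ) (c : PBond P (j + 1)) :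
    bondAvg (fun e => ∑ t, K e t • M t) c = ∑ t, bondAvg (fun e => K e t) c • M t := by
  classical
  let φ : (ι → ℝ) →ₗ[ℝ] Matrix n n ℂ :=
    { toFun := fun w => ∑ t, w t • M t
      map_add' := fun w w' => by simp only [Pi.add_apply, add_smul, Finset.sum_add_distrib]
      map_smul' := fun r w => by simp only [Pi.smul_apply, smul_eq_mul, mul_smul, Finset.smul_sum, RingHom.id_apply] }
  have h := bondAvg_comp_apply φ (fun e => K e) c
  simp only [φ, LinearMap.coe_mk, AddHom.coe_mk] at h
  rw [h]
  congr 1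
  funext t
  congr 1
  exact (bondAvg_comp_apply (LinearMap.proj t : (ι → ℝ) →ₗ[ℝ] ℝ) (fun e => K e) c).symm

end FarFace

/-! ## §2  The flat site block -/

section Block

variable {n : ℕ}

/-- ★★★ **THE FLAT SITE BLOCK.**  For every site `y′` of `T^{(n+1)}` (`n + 1 ≤ m + K`) there is a REAL-LINEAR map `Φ` from data on the `(n+1)`-bonds to fine `𝔰𝔲(N)`-fields such that:
(i) for EVERY `linAvg`-family `Q` (`Q⁰ = id`, `Q^{i+1} = linAvg ∘ Q^{i}`; `= qLin · 1` on `𝔰𝔲(N)`-fields) and every datum `v`, `Q^{(n+1)}(↑Φ v)(c) = ↑(v c)` at every row `c` at `y′`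
(`c₋ = y′` or `c₊ = y′`); (ii) every bond `b` in the support of `Φ v` has both its `(n+1)`-blocks equal to `y′` and its two `n`-blocks DIFFERENT (it crosses an internal `n`-face of
`B(y′)`); (iii) `‖Φ v‖ ≤ C‖v‖` for one `C ≥ 0` (sup norms; finite dimension).  Construction in the module docstring. [cite: Balaban1985Variational, (44)-(46) p.285; Balaban1984PropagatorsI, (1.11) p.19, (1.18) p.20; Balaban1985Averaging, (62) p.28, (124)-(125) p.36] -/
theorem exists_flat_siteBlock (hn : n + 1 ≤ P.m + P.K) (y' : Site P (n + 1)) :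
    ∃ Φ : (PBond P (n + 1) → lieSU (Fin N)) →ₗ[ℝ] (PBond P 0 → lieSU (Fin N)),
      (∀ (Q : (i : ℕ) → (PBond P 0 → Matrix (Fin N) (Fin N) ℂ) → PBond P i → Matrix (Fin N) (Fin N) ℂ),
        (∀ Y, Q 0 Y = Y) → (∀ (i : ℕ) (Y : PBond P 0 → Matrix (Fin N) (Fin N) ℂ) (c : PBond P (i + 1)), Q (i + 1) Y c = linAvg (Q i Y) c) →
        ∀ (v : PBond P (n + 1) → lieSU (Fin N)) (c : PBond P (n + 1)), (c.src = y' ∨ c.tgt = y') →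
          Q (n + 1) (fun b => (Φ v b : Matrix (Fin N) (Fin N) ℂ)) c = (v c : Matrix (Fin N) (Fin N) ℂ)) ∧
      (∀ v (b : PBond P 0), Φ v b ≠ 0 →
        iterBlockOf (n + 1) b.src = y' ∧ iterBlockOf (n + 1) b.tgt = y' ∧ iterBlockOf n b.src ≠ iterBlockOf n b.tgt) ∧
      ∃ C : ℝ, 0 ≤ C ∧ ∀ v, ‖Φ v‖ ≤ C * ‖v‖ := by
  classical
  have hn' : n ≤ P.m + P.K := Nat.le_of_succ_le hn
  have hLC : (P.L : ℂ) ≠ 0 := Nat.cast_ne_zero.mpr P.L_pos.ne'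
  -- H1a at the single inside block `y'`: for every `(n+1)`-bond `t` a level-`n` field on the internal bonds of `B(y')` with straight average `δ_t` on the rows at `y'`
  choose Z hZrow hZsupp using fun t : PBond P (n + 1) =>
    exists_bondAvg_eq_on_rows hn (fun w => w = y') (fun c => c.src = y' ∨ c.tgt = y') (fun _ h => h) (fun c => if c = t then (1 : ℝ) else 0)
  -- the centre gradient one level down and its internality
  let G : VecField P n ℝ := fun e => (if e.tgt = emb y' then (1 : ℝ) else 0) - (if e.src = emb y' then 1 else 0)
  have hGsupp : ∀ e : PBond P n, G e ≠ 0 → blockOf e.src = y' ∧ blockOf e.tgt = y' := by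
    intro e he
    by_cases h1 : e.tgt = emb y'
    · refine ⟨?_, by rw [h1, Site.blockOf_emb hn]⟩
      have hsrc : e.src = (emb y').unshift e.dir := by
        rw [← h1]; exact (B10StarCount.unshift_shift e.src e.dir).symm
      rw [hsrc, blockOf_unshift_emb hn]
    · by_cases h2 : e.src = emb y'
      · refine ⟨by rw [h2, Site.blockOf_emb hn], ?_⟩
        show blockOf (e.src.shift e.dir) = y'
        rw [h2, blockOf_shift_emb hn]
      · exact absurd (by simp only [G, h1, h2, if_false, sub_self]) he
  -- one real kernel family over `Option`: `none ↦ G`, `some t ↦ Z t`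
  let Z' : Option (PBond P (n + 1)) → VecField P n ℝ := fun o => o.elim G Z
  have hZ'supp : ∀ o (e : PBond P n), Z' o e ≠ 0 → blockOf e.src = y' ∧ blockOf e.tgt = y' := by
    rintro (_ | t) e he
    · exact hGsupp e he
    · exact hZsupp t e he
  -- scaled targets, the level-`n` datum, the comb constant, the matrix coefficients, the fine field
  let T : (PBond P (n + 1) → lieSU (Fin N)) → PBond P (n + 1) → Matrix (Fin N) (Fin N) ℂ :=
    fun v t => (((P.L : ℂ) ^ (n + 1))⁻¹) • (v t : Matrix (Fin N) (Fin N) ℂ)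
  let W : (PBond P (n + 1) → lieSU (Fin N)) → PBond P n → Matrix (Fin N) (Fin N) ℂ := fun v e => ∑ t, Z t e • T v t
  let K : (PBond P (n + 1) → lieSU (Fin N)) → Matrix (Fin N) (Fin N) ℂ := fun v => combMean (W v) y'
  let M : (PBond P (n + 1) → lieSU (Fin N)) → Option (PBond P (n + 1)) → Matrix (Fin N) (Fin N) ℂ := fun v o => o.elim (K v) (T v)
  let Y : (PBond P (n + 1) → lieSU (Fin N)) → PBond P 0 → Matrix (Fin N) (Fin N) ℂ := fun v b => ∑ o, liftIter n (Z' o) b • M v o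
  -- linearity of the pieces
  have hT_add : ∀ v w, T (v + w) = T v + T w := fun v w => funext fun t => by
    simp only [T, Pi.add_apply, Submodule.coe_add, smul_add]
  have hT_smul : ∀ (r : ℝ) v, T (r • v) = r • T v := fun r v => funext fun t => by
    simp only [T, Pi.smul_apply, Submodule.coe_smul]; rw [smul_comm]
  have hW_add : ∀ v w, W (v + w) = fun e => W v e + W w e := fun v w => funext fun e => by
    simp only [W, hT_add, Pi.add_apply, smul_add, Finset.sum_add_distrib]
  have hW_smul : ∀ (r : ℝ) v, W (r • v) = fun e => r • W v e := fun r v => funext fun e => by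
    simp only [W, hT_smul, Pi.smul_apply, Finset.smul_sum]
    exact Finset.sum_congr rfl fun t _ => smul_comm _ _ _
  have hK_add : ∀ v w, K (v + w) = K v + K w := fun v w => by
    show combMean (W (v + w)) y' = _; rw [hW_add]; exact combMean_add _ _ _
  have hK_smul : ∀ (r : ℝ) v, K (r • v) = r • K v := fun r v => by
    show combMean (W (r • v)) y' = _; rw [hW_smul]
    exact Summit.QuantumFields.YangMills.Theorems.ChartHInv.combMean_real_smul r (W v) y'
  have hM_add : ∀ v w o, M (v + w) o = M v o + M w o := by
    rintro v w (_ | t)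
    · exact hK_add v w
    · show T (v + w) t = T v t + T w t; rw [hT_add]; rfl
  have hM_smul : ∀ (r : ℝ) v o, M (r • v) o = r • M v o := by
    rintro r v (_ | t)
    · exact hK_smul r v
    · show T (r • v) t = r • T v t; rw [hT_smul]; rfl
  have hY_add : ∀ v w b, Y (v + w) b = Y v b + Y w b := fun v w b => by
    simp only [Y, hM_add, smul_add, Finset.sum_add_distrib]
  have hY_smul : ∀ (r : ℝ) v b, Y (r • v) b = r • Y v b := fun r v b => by
    simp only [Y, hM_smul, Finset.smul_sum]
    exact Finset.sum_congr rfl fun o _ => smul_comm _ _ _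
  -- the real-linear map
  let Φ : (PBond P (n + 1) → lieSU (Fin N)) →ₗ[ℝ] (PBond P 0 → lieSU (Fin N)) :=
    { toFun := fun v b => suProj N (Y v b)
      map_add' := fun v w => funext fun b => by rw [Pi.add_apply, hY_add, map_add]
      map_smul' := fun r v => funext fun b => by rw [Pi.smul_apply, RingHom.id_apply, hY_smul, map_smul] }
  have hΦ : ∀ v b, Φ v b = suProj N (Y v b) := fun _ _ => rfl
  have hbound : ∃ C : ℝ, 0 ≤ C ∧ ∀ v, ‖Φ v‖ ≤ C * ‖v‖ := by
    obtain ⟨C, hCpos, hC⟩ := SemilinearMapClass.bound_of_continuous Φ (LinearMap.continuous_of_finiteDimensional Φ)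
    exact ⟨C, hCpos.le, hC⟩
  refine ⟨Φ, fun Q hQ0 hQs v c hc => ?_, fun v b hb => ?_, hbound⟩
  · -- ### (i) the identity on the rows at `y'`
    -- `π` commutes with `Q^{(n+1)}`
    let π : Matrix (Fin N) (Fin N) ℂ →ₗ[ℝ] Matrix (Fin N) (Fin N) ℂ := (lieSU (Fin N)).subtype ∘ₗ (suProj N).toLinearMap
    have hπ : ∀ A, π A = ((suProj N A : lieSU (Fin N)) : Matrix (Fin N) (Fin N) ℂ) := fun _ => rfl
    have hcoe : (fun b => (Φ v b : Matrix (Fin N) (Fin N) ℂ)) = fun b => π (Y v b) := funext fun b => by rw [hΦ, hπ]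
    rw [hcoe, linFamily_realLinear Q hQ0 hQs π (Y v) (n + 1) c, hπ]
    suffices hY : Q (n + 1) (Y v) c = (v c : Matrix (Fin N) (Fin N) ℂ) by rw [hY, suProj_coe]
    -- one flat step on top of `Q^{(n)}Y = L^n·(W + G ⊗ K)`
    have hQn : Q n (Y v) = fun e => (P.L ^ n : ℕ) • (W v e + G e • K v) := by
      funext e
      rw [show Y v = fun b => ∑ o, liftIter n (Z' o) b • M v o from rfl, linFamily_liftIter_kernel Q hQ0 hQs hn' Z' (M v) e,
        Fintype.sum_option]
      show (P.L ^ n : ℕ) • (G e • K v + ∑ t, Z t e • T v t) = _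
      rw [add_comm]
    -- the gradient part as the gradient of a matrix site function
    let lam : Site P n → Matrix (Fin N) (Fin N) ℂ := fun x => (if x = emb y' then (1 : ℝ) else 0) • K v
    have hG : (fun e : PBond P n => G e • K v) = fun e => lam e.tgt - lam e.src := funext fun e => by
      simp only [G, lam, sub_smul]
    have hlam : ∀ u : Site P (n + 1), lam (emb u) = if u = y' then K v else 0 := fun u => by
      by_cases hu : u = y'
      · simp only [lam, hu, if_true, one_smul]
      · have hne : emb u ≠ emb y' := fun h => hu (by rw [← Site.blockOf_emb hn u, h, Site.blockOf_emb hn])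
        simp only [lam, hne, hu, if_false, zero_smul]
    -- the straight part on a row, the comb means of `W v`
    have hWavg : bondAvg (W v) c = T v c := by
      rw [show W v = fun e => ∑ t, Z t e • T v t from rfl, bondAvg_kernel_apply (fun e t => Z t e) (T v) c]
      have hZ : ∀ t, bondAvg (fun e => Z t e) c = if c = t then 1 else 0 := fun t => hZrow t c hc
      simp only [hZ, ite_smul, one_smul, zero_smul, Finset.sum_ite_eq, Finset.mem_univ, if_true]
    have hWsupp : ∀ e : PBond P n, W v e ≠ 0 → blockOf e.src = y' ∧ blockOf e.tgt = y' := fun e he => by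
      obtain ⟨t, -, ht⟩ := Finset.exists_ne_zero_of_sum_ne_zero he
      exact hZsupp t e (left_ne_zero_of_smul ht)
    have hsrc_ne_tgt : c.src ≠ c.tgt := (T4WilsonLinkAffine.shift_ne_self c.src c.dir).symm
    -- assemble
    rw [hQs, hQn]
    have hsplit : (fun e => (P.L ^ n : ℕ) • (W v e + G e • K v)) = fun e => ((P.L : ℂ) ^ n) • W v e + ((P.L : ℂ) ^ n) • (lam e.tgt - lam e.src) := by
      funext e
      rw [← Nat.cast_smul_eq_nsmul ℂ, Nat.cast_pow, smul_add, show G e • K v = lam e.tgt - lam e.src from congrFun hG e]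
    rw [hsplit, linAvg_add, linAvg_const_smul, linAvg_const_smul,
      show (fun e => lam e.tgt - lam e.src) = fun e : PBond P n => lam e.tgt - lam e.src from rfl, linAvg_grad,
      linAvg_eq_bondAvg_sub_grad_combMean, hWavg, hlam, hlam]
    have hT : ((P.L : ℂ) ^ n) • (((P.L : ℕ) : ℂ) • T v c) = (v c : Matrix (Fin N) (Fin N) ℂ) := by
      simp only [T, smul_smul]
      rw [show (P.L : ℂ) ^ n * ((P.L : ℂ) * ((P.L : ℂ) ^ (n + 1))⁻¹) = 1 by
        rw [← mul_assoc, ← pow_succ, mul_inv_cancel₀ (pow_ne_zero _ hLC)], one_smul]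
    rcases hc with hcs | hct
    · have hct : c.tgt ≠ y' := fun h => hsrc_ne_tgt (hcs.trans h.symm)
      rw [if_neg hct, if_pos hcs, combMean_eq_zero_of_internal hn hWsupp hct, hcs, zero_sub, sub_neg_eq_add, smul_add, hT, smul_neg]
      show (v c : Matrix (Fin N) (Fin N) ℂ) + (P.L : ℂ) ^ n • combMean (W v) y' + -((P.L : ℂ) ^ n • combMean (W v) y') = (v c : Matrix (Fin N) (Fin N) ℂ)
      rw [add_neg_cancel_right]
    · have hcs : c.src ≠ y' := fun h => hsrc_ne_tgt (h.trans hct.symm)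
      rw [if_pos hct, if_neg hcs, combMean_eq_zero_of_internal hn hWsupp hcs, hct, sub_zero, smul_sub, hT]
      show (v c : Matrix (Fin N) (Fin N) ℂ) - (P.L : ℂ) ^ n • combMean (W v) y' + (P.L : ℂ) ^ n • combMean (W v) y' = (v c : Matrix (Fin N) (Fin N) ℂ)
      rw [sub_add_cancel]
  · -- ### (ii) the support
    have hY : Y v b ≠ 0 := fun h => hb (by rw [hΦ, h, map_zero])
    obtain ⟨o, -, ho⟩ := Finset.exists_ne_zero_of_sum_ne_zero hY
    have hlift : liftIter n (Z' o) b ≠ 0 := left_ne_zero_of_smul ho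
    obtain ⟨h1, h2⟩ := liftIter_support n hn' (Z' o) b hlift
    obtain ⟨hs, ht⟩ := hZ'supp o _ h1
    refine ⟨?_, ?_, fun h => ?_⟩
    · rw [iterBlockOf_succ]; exact hs
    · rw [iterBlockOf_succ, h2]; exact ht
    · rw [← h] at h2
      exact T4WilsonLinkAffine.shift_ne_self _ b.dir h2.symm

end Block

end Summit.QuantumFields.YangMills.BalabanUVNodes.N12DirectSurjSiteBlockFlat

end
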